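import Summits.CriticalPhenomena.PercolationContinuityZ3.Theorems.PercNearOneGluingNoHeavyQuantAD3HeavyTop
import Summits.CriticalPhenomena.PercolationContinuityZ3.Theorems.PercNearOneGluingNoHeavyQuantGateMoveBlobCellsZero
import HarnessLib

/-!
# QUANT lane R8, T-DEC: THE ONE-LOW PEELING LEMMA — a law whose low atoms are `0` and ONE positive atom `lo` is DEC at the target at
# every layer as soon as a single partner atom `P` can take `lo` (capacity `μ lo·γ ≤ μ P·(1−γ)` at the gate `γ = max(y, (T−2lo)/(P−lo))`)
# and the pair's mean stays below the target (`y·(P−lo) ≤ T−lo`); the remainder is the first-moment criterion (census-1 gen 24)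

builds on p205010 (kernel theorem, internal audit signed; external expert review pending)

Support file (`--supports stmt-CriticalPhenomena-4575`), QUANT lane seat prim-quant-census-1 (gen 24); memo
`run/shared/lean/prim/quant/prim-quant-census-1/RESID-DEC-G24.md` §3.  Theorems only (no definitions, no `@[conjecture]`), standard axioms, no
sorries.  Uses typer g22's flow normal form (`flowAtT_of_moment`, `decAtT_of_flowAtT`: `…QuantFlowPieces`, `…QuantLawDecFlowsDecomposition`) and
`decAtT_mixture` (`…QuantDECAtTarget`), `sum_mul_TP_range` (`…QuantGateMoveBlobCellsZero`).

WHY.  Claim (II) of README V428 at COUNT level (memo §1–§3; arm-1 g49 `…QuantRootScaledHeavyRoots` for the pair-free regime): the residual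
`R_a = resid a (wco a L) L` of the top-level expansion must be DEC at floor `a·x`, target `T = a·fmean L`, at every layer.  Its low atoms are `0`
(always absorbable by levers `{0, h; T/h}`, the torque identity — typer g22's `flowAtT_of_moment`, arm-1 g49's `decAt_resid_of_noLow`) and the
few positive atoms below `T/2`.  The census of this seat (19 217 exact instances) finds that ONE floor-gate or credit pair per positive low atom
suffices with slack; this file is the kernel form of the simplest case, ONE positive low atom — e.g. census-2's regression witness
`(R¹[q](R²[s]))³`, whose residual charges the low atom `2 = 2A` once `a·fmean > 4` (arm-1 g49 ARCH-G49 §3's 'two-source flow'); the explicit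
family is the sequel `…QuantWitnessForestSDEC`.

THE LEMMA (`decAtT_all_of_oneLow`).  `μ ≥ 0` on `{0..M}`, mass `1`, mean `T > 0`, floor `0 < y < 1`, `y·M ≤ T`, `μ 0 > 0`; a positive low atom
`lo` (`2·lo < T`) such that every OTHER charged positive atom is self-sufficient (`T ≤ 2h`); a partner `lo < P ≤ M` with `T < lo + P`; the gate
`γ := max(y, (T − 2·lo)/(P − lo))` (the least gate making `{lo, P; γ}` valid at every layer: `γ ≥ y` for the giant rule, credit
`2·lo + (P − lo)·γ ≥ T` for the mid rule); CAPACITY `μ lo · γ ≤ μ P · (1 − γ)` and TORQUE SAFETY `y·(P − lo) ≤ T − lo` (the pair's mean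
`lo + (P − lo)·γ` is `≤ T`).  Then `DECAtT y T j′ M μ` for every `j′`.  PROOF: peel `μ = λ·{lo, P; γ} + (1 − λ)·μ″` with `λ = μ lo/(1 − γ) < 1`
(`μ 0 > 0`); the pair is valid at every layer (`decAtT_all_pair`); `μ″` has no positive low atom, mass `1`, mean `≥ T` (torque safety), so it is
DEC at target `T` at every layer by the first-moment criterion (`decAtT_all_of_noLow_target` = `flowAtT_of_moment` ∘ `decAtT_of_flowAtT`);
`decAtT_mixture`.

* **`decAtT_all_pair`** (a floor-heavy credit pair is DEC at the target at every layer),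
  **`decAtT_all_of_noLow_target`** (no positive low atom, mean `≥ T` ⟹ DEC at target `T`, every layer), **`decAtT_all_of_oneLow`**,
  **`decAt_all_of_oneLow`** (at the mean).

HONEST STATUS: a count-level certificate lemma; `SiblingStep`, `GateStepN`, `FarTreeRow` OPEN; RATE class log\* / honest sentence of
`run/shared/lean/prim/quant/README.md` unchanged.  [this work]; flow normal form: prim-quant-stmt g22; first-moment criterion: this lane; two-source
reading of the witness: prim-quant-arm-1 g49.  Nothing here is cited as a published result.  The gluing rows served
[cite: KozmaNitzan2024, Conjecture 3 (p. 15)]; product measure [cite: Grimmett1999, §1.3 p. 10].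
-/

noncomputable section

open scoped BigOperators

namespace Summit.CriticalPhenomena.PercolationContinuityZ3.Theorems
namespace Quant

open Finset

/-- the two-point law `{lo, hi; g}` (as in `…QuantLawDEC`) -/
local notation3 "TP[" lo ", " hi ", " g ", " h "]" =>
  (g : ℝ) * (if (h : ℕ) = (hi : ℕ) then (1 : ℝ) else 0) + (1 - (g : ℝ)) * (if (h : ℕ) = (lo : ℕ) then (1 : ℝ) else 0)

namespace LawDec

/-! ### Two-point laws -/

/-- **A FLOOR-HEAVY CREDIT PAIR IS DEC AT THE TARGET AT EVERY LAYER**: `{lo, hi; g}` with `lo < hi ≤ M`, `0 ≤ g ≤ 1`, `y ≤ g` and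
`T ≤ 2·lo + (hi − lo)·g` is `DECAtT y T j′ M` for every `j′` (rule (G) when `hi ≥ j′+1`, rule (N) with `κ_y(g) = g` otherwise). [this work] -/
theorem decAtT_all_pair (y T : ℝ) (M lo hi : ℕ) (g : ℝ) (hlt : lo < hi) (hhi : hi ≤ M) (hg0 : 0 ≤ g) (hg1 : g ≤ 1) (hyg : y ≤ g)
    (hcr : T ≤ 2 * (lo : ℝ) + ((hi : ℝ) - lo) * g) (j' : ℕ) : DECAtT y T j' M (fun h => TP[lo, hi, g, h]) := by
  refine ⟨Unit, inferInstance, fun _ => 1, fun _ => g, fun _ => lo, fun _ => hi, fun _ => zero_le_one, by simp, fun _ => ⟨hg0, hg1⟩,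
    fun _ => hlt.le, fun _ => hhi, fun h => by simp, fun _ _ => ?_⟩
  show ValidAt y T j' lo hi g
  by_cases hgi : j' + 1 ≤ hi
  · exact Or.inr (Or.inl ⟨hlt, hgi, hyg⟩)
  · refine Or.inr (Or.inr ⟨hlt, by omega, ?_⟩)
    rw [if_pos hyg]
    exact hcr

/-! ### No positive low atom, at a target below the mean -/

/-- **THE FIRST-MOMENT CRITERION AT A TARGET BELOW THE MEAN.**  `μ ≥ 0` on `{0..M}`, mass `1`, floor `0 < y < 1`, target `0 < T`,
`y·M ≤ T`, mean `≥ T`, and every charged positive atom self-sufficient (`T ≤ 2h`): then `DECAtT y T j′ M μ` for every `j′`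
(`flowAtT_of_moment` + `decAtT_of_flowAtT`). [this work] -/
theorem decAtT_all_of_noLow_target (y T : ℝ) (M : ℕ) (μ : ℕ → ℝ) (hy0 : 0 < y) (hy1 : y < 1) (hT : 0 < T)
    (hμ0 : ∀ h, 0 ≤ μ h) (hμM : ∀ h, M < h → μ h = 0) (hμ1 : ∑ h ∈ Finset.range (M + 1), μ h = 1)
    (hbig : ∀ h, 1 ≤ h → 0 < μ h → T ≤ 2 * (h : ℝ)) (hta : y * (M : ℝ) ≤ T)
    (hmom : T ≤ ∑ h ∈ Finset.range (M + 1), (h : ℝ) * μ h) : ∀ j', DECAtT y T j' M μ := by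
  intro j'
  refine decAtT_of_flowAtT y T j' M μ hy0 hy1 hμM hμ1
    (flowAtT_of_moment y T j' M μ hy0 hy1 hT hμ0 (fun l hl1 _ hlow => ?_) hta (by rw [hμ1, mul_one]; exact hmom))
  by_contra hne
  have hpos : 0 < μ l := lt_of_le_of_ne (hμ0 l) (Ne.symm hne)
  have := hbig l hl1 hpos
  linarith

/-! ### One positive low atom -/

/-- **THE ONE-LOW PEELING LEMMA (target form).**  See the file header: low atoms `{0, lo}`, a partner `P` with capacity at the gate
`γ = max(y, (T−2lo)/(P−lo))` and torque safety `y·(P−lo) ≤ T−lo` ⟹ `DECAtT y T j′ M μ` at every layer `j′`. [this work] -/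
theorem decAtT_all_of_oneLow (y T : ℝ) (M lo P : ℕ) (μ : ℕ → ℝ) (hy0 : 0 < y) (hy1 : y < 1)
    (hμ0 : ∀ h, 0 ≤ μ h) (hμM : ∀ h, M < h → μ h = 0) (hμ1 : ∑ h ∈ Finset.range (M + 1), μ h = 1)
    (hmean : ∑ h ∈ Finset.range (M + 1), (h : ℝ) * μ h = T) (h0 : 0 < μ 0)
    (hlo0 : 0 < lo) (hlow : 2 * (lo : ℝ) < T) (hloP : lo < P) (hPM : P ≤ M) (hcomp : T < (lo : ℝ) + P)
    (hothers : ∀ h, 1 ≤ h → h ≠ lo → 0 < μ h → T ≤ 2 * (h : ℝ)) (hta : y * (M : ℝ) ≤ T)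
    (hsafe : y * ((P : ℝ) - lo) ≤ T - lo)
    (hcap : μ lo * max y ((T - 2 * (lo : ℝ)) / ((P : ℝ) - lo)) ≤ μ P * (1 - max y ((T - 2 * (lo : ℝ)) / ((P : ℝ) - lo)))) :
    ∀ j', DECAtT y T j' M μ := by
  classical
  intro j'
  set γ : ℝ := max y ((T - 2 * (lo : ℝ)) / ((P : ℝ) - lo)) with hγ
  have hPlo : (0 : ℝ) < (P : ℝ) - lo := by
    have : (lo : ℝ) < P := by exact_mod_cast hloP
    linarith
  have hT0 : 0 < T := by
    have : (0 : ℝ) ≤ lo := Nat.cast_nonneg lo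
    linarith
  -- facts about γ
  have hyγ : y ≤ γ := le_max_left _ _
  have hργ : (T - 2 * (lo : ℝ)) / ((P : ℝ) - lo) ≤ γ := le_max_right _ _
  have hγ0 : 0 < γ := lt_of_lt_of_le hy0 hyγ
  have hγ1 : γ < 1 := by
    refine max_lt hy1 ?_
    rw [div_lt_one hPlo]
    linarith
  have hcr : T ≤ 2 * (lo : ℝ) + ((P : ℝ) - lo) * γ := by
    have := mul_le_mul_of_nonneg_left hργ hPlo.le
    rw [mul_div_cancel₀ _ hPlo.ne'] at this
    linarith
  -- the pair's mean is at most the target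
  have hpm : (lo : ℝ) + ((P : ℝ) - lo) * γ ≤ T := by
    rcases le_total y ((T - 2 * (lo : ℝ)) / ((P : ℝ) - lo)) with hle | hle
    · rw [hγ, max_eq_right hle, mul_div_cancel₀ _ hPlo.ne']
      have : (0 : ℝ) ≤ lo := Nat.cast_nonneg lo
      linarith
    · rw [hγ, max_eq_left hle]
      linarith [hsafe]
  -- the peeled weight
  have hloM : lo ≤ M := hloP.le.trans hPM
  have hPne : P ≠ lo := by omega
  have h0lo : (0 : ℕ) ≠ lo := by omega
  have h0P : (0 : ℕ) ≠ P := by omega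
  have hsum3 : μ 0 + μ lo + μ P ≤ 1 := by
    have hsub : ({0, lo, P} : Finset ℕ) ⊆ Finset.range (M + 1) := by
      intro h hh
      simp only [Finset.mem_insert, Finset.mem_singleton] at hh
      rw [Finset.mem_range]
      rcases hh with rfl | rfl | rfl <;> omega
    have := Finset.sum_le_sum_of_subset_of_nonneg hsub (fun h _ _ => hμ0 h)
    rw [hμ1, Finset.sum_insert (by simp [h0lo, h0P]), Finset.sum_insert (by simp [hPne.symm]), Finset.sum_singleton] at this
    linarith
  set lam : ℝ := μ lo / (1 - γ) with hlam
  have h1γ : 0 < 1 - γ := by linarith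
  have hlam0 : 0 ≤ lam := div_nonneg (hμ0 lo) h1γ.le
  have hloγ : μ lo ≤ (1 - γ) * (1 - μ 0) := by
    -- from the capacity: μ lo·γ ≤ μ P·(1−γ) ≤ (1 − μ lo − μ 0)(1 − γ)
    have h1 : μ P ≤ 1 - μ lo - μ 0 := by linarith
    have h2 : μ lo * γ ≤ (1 - μ lo - μ 0) * (1 - γ) := hcap.trans (mul_le_mul_of_nonneg_right h1 h1γ.le)
    nlinarith
  have hlam1 : lam < 1 := by
    rw [hlam, div_lt_one h1γ]
    have : (1 - γ) * (1 - μ 0) < 1 - γ := by nlinarith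
    linarith
  have h1lam : 0 < 1 - lam := by linarith
  -- the remainder law
  set ν : ℕ → ℝ := fun h => (μ h - lam * TP[lo, P, γ, h]) / (1 - lam) with hν
  have hmix : ∀ h, μ h = lam * TP[lo, P, γ, h] + (1 - lam) * ν h := by
    intro h
    simp only [hν]
    field_simp
    ring
  have hne1 : (1 - γ) ≠ 0 := h1γ.ne'
  have hne2 : (1 - lam) ≠ 0 := h1lam.ne'
  have hνlo : ν lo = 0 := by
    have e : ν lo = (μ lo - lam * TP[lo, P, γ, lo]) / (1 - lam) := rfl
    rw [e, if_neg (by omega : lo ≠ P), if_pos rfl, hlam]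
    field_simp
    ring
  have hνP : 0 ≤ ν P := by
    have e : ν P = (μ P - lam * TP[lo, P, γ, P]) / (1 - lam) := rfl
    rw [e, if_pos rfl, if_neg hPne]
    refine div_nonneg ?_ h1lam.le
    have : lam * γ ≤ μ P := by
      rw [hlam, div_mul_eq_mul_div, div_le_iff₀ h1γ]
      exact hcap
    linarith
  have hνother : ∀ h, h ≠ lo → h ≠ P → ν h = μ h / (1 - lam) := by
    intro h h1 h2
    have e : ν h = (μ h - lam * TP[lo, P, γ, h]) / (1 - lam) := rfl
    rw [e, if_neg h2, if_neg h1]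
    ring
  have hν0 : ∀ h, 0 ≤ ν h := by
    intro h
    by_cases h1 : h = lo
    · rw [h1, hνlo]
    · by_cases h2 : h = P
      · rw [h2]; exact hνP
      · rw [hνother h h1 h2]; exact div_nonneg (hμ0 h) h1lam.le
  have hνM : ∀ h, M < h → ν h = 0 := by
    intro h hh
    rw [hνother h (by omega) (by omega), hμM h hh, zero_div]
  have hν1 : ∑ h ∈ Finset.range (M + 1), ν h = 1 := by
    have e : ∑ h ∈ Finset.range (M + 1), ν h = (∑ h ∈ Finset.range (M + 1), μ h - lam * ∑ h ∈ Finset.range (M + 1), TP[lo, P, γ, h]) / (1 - lam) := by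
      rw [Finset.mul_sum, ← Finset.sum_sub_distrib, Finset.sum_div]
    rw [e, hμ1, sum_TP_range M lo P γ hloM hPM, mul_one, div_self h1lam.ne']
  have hνmean : T ≤ ∑ h ∈ Finset.range (M + 1), (h : ℝ) * ν h := by
    have e : ∑ h ∈ Finset.range (M + 1), (h : ℝ) * ν h
        = (∑ h ∈ Finset.range (M + 1), (h : ℝ) * μ h - lam * ∑ h ∈ Finset.range (M + 1), (h : ℝ) * TP[lo, P, γ, h]) / (1 - lam) := by
      rw [Finset.mul_sum, ← Finset.sum_sub_distrib, Finset.sum_div]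
      refine Finset.sum_congr rfl fun h _ => ?_
      show (h : ℝ) * ((μ h - lam * TP[lo, P, γ, h]) / (1 - lam)) = _
      ring
    rw [e, hmean, sum_mul_TP_range M lo P γ hloM hPM, le_div_iff₀ h1lam]
    nlinarith [hpm, hlam0]
  have hνbig : ∀ h, 1 ≤ h → 0 < ν h → T ≤ 2 * (h : ℝ) := by
    intro h h1 hpos
    by_cases hl : h = lo
    · rw [hl, hνlo] at hpos; exact absurd hpos (lt_irrefl 0)
    · by_cases hP : h = P
      · -- `P > T − lo > T/2`
        rw [hP]
        have : (lo : ℝ) < P := by exact_mod_cast hloP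
        linarith
      · refine hothers h h1 hl ?_
        rw [hνother h hl hP] at hpos
        by_contra hle
        have : μ h = 0 := le_antisymm (not_lt.1 hle) (hμ0 h)
        rw [this, zero_div] at hpos
        exact lt_irrefl _ hpos
  -- assemble
  have hpair := decAtT_all_pair y T M lo P γ hloP hPM hγ0.le hγ1.le hyγ hcr j'
  have hrem := decAtT_all_of_noLow_target y T M ν hy0 hy1 hT0 hν0 hνM hν1 hνbig hta hνmean j'
  have e : μ = fun h => lam * TP[lo, P, γ, h] + (1 - lam) * ν h := funext hmix
  rw [e]
  exact decAtT_mixture lam hlam0 hlam1.le hpair hrem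

/-- **THE ONE-LOW PEELING LEMMA (at the mean).**  As `decAtT_all_of_oneLow`, concluding `DECAt y j′ M μ` for every `j′`. [this work] -/
theorem decAt_all_of_oneLow (y T : ℝ) (M lo P : ℕ) (μ : ℕ → ℝ) (hy0 : 0 < y) (hy1 : y < 1)
    (hμ0 : ∀ h, 0 ≤ μ h) (hμM : ∀ h, M < h → μ h = 0) (hμ1 : ∑ h ∈ Finset.range (M + 1), μ h = 1)
    (hmean : ∑ h ∈ Finset.range (M + 1), (h : ℝ) * μ h = T) (h0 : 0 < μ 0)
    (hlo0 : 0 < lo) (hlow : 2 * (lo : ℝ) < T) (hloP : lo < P) (hPM : P ≤ M) (hcomp : T < (lo : ℝ) + P)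
    (hothers : ∀ h, 1 ≤ h → h ≠ lo → 0 < μ h → T ≤ 2 * (h : ℝ)) (hta : y * (M : ℝ) ≤ T)
    (hsafe : y * ((P : ℝ) - lo) ≤ T - lo)
    (hcap : μ lo * max y ((T - 2 * (lo : ℝ)) / ((P : ℝ) - lo)) ≤ μ P * (1 - max y ((T - 2 * (lo : ℝ)) / ((P : ℝ) - lo)))) :
    ∀ j', DECAt y j' M μ := by
  intro j'
  rw [decAt_iff_decAtT, hmean]
  exact decAtT_all_of_oneLow y T M lo P μ hy0 hy1 hμ0 hμM hμ1 hmean h0 hlo0 hlow hloP hPM hcomp hothers hta hsafe hcap j'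

end LawDec
end Quant
end Summit.CriticalPhenomena.PercolationContinuityZ3.Theorems
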